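import Summits.QuantumAdvantage.QuantumAdvantage.Theses.WhiteBoxWalk
import Literature.Computability.QuantumComplexity.GluedTreesThm9Graph
import Literature.Computability.Cryptography.IndistinguishabilityObfuscatorSubexp
import Literature.Computability.Cryptography.PuncturablePRF

/-!
# `WbwObfuscatedGluedTrees` (stmt-QuantumAdvantage-2340) — I: typed shape and LOAD-BEARING analysis

Support / negative lemmas for the INFORMAL crux `WbwObfuscatedGluedTrees` of route
`Summits/QuantumAdvantage/QuantumAdvantage/Theses/WhiteBoxWalk` ("sub-exponentially secure iO +
`(t,δ)`-puncturable PRF + injective OWF ⇒ clause (C) of `WbwThesis` for the obfuscated glued-trees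
generator `gen s = (iO(N_k), name_k(ENTRANCE))`, `ans s = name_k(EXIT)`"), extracted from the refuter
work file `Summits/QuantumAdvantage/QuantumAdvantage/Cruxes/WbwObfuscatedGluedTrees/Disproof.lean`
(cycle 1, refuter-cdisprove-stmt-QuantumAdvantage-2340-0) so that planners, ideators and provers can
IMPORT them (the work file is overwritten by every generation). Sorry-free; no Theses decl is asserted.

* §0 `ClauseC` (verbatim sub-formula of `WbwThesis`), `wbwThesis_iff` (`Iff.rfl`), `GenType`,
  `CruxShape obfGen` (the typed shape the planner's signature will have once the requested definition
  `obfuscatedGluedTreesGen` lands), and `not_cruxShape_imp`: a proof of `¬ CruxShape obfGen` yields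
  `SubexpIOExist ε` (some `ε ∈ (0,1)`), a `(t,δ)`-secure puncturable PRF and an injective one-way
  function — so no UNCONDITIONAL refutation of the typed crux can exist in the tree; refutations are
  necessarily "modulo H", and modulo H a kill is a universal white-box EXIT-finder.
* `Graph`: `degree_eq_two_iff` (EXIT is publicly verifiable: the degree-2 vertices of `G'_n`, `1 ≤ n`,
  are exactly the two roots), adjacency of `childV`/`parentV`/`cross₁`, `eq_exit_of_adj_child_exit`.
* §1 `RoleOrder`: the mutant whose neighbour circuit lists neighbours in ROLE order is broken —
  `roleWalk_eq_exit` reaches EXIT in `2n+1` evaluations on every instance (typing obligation: the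
  adjacency lists must be SORTED, as in `gluedTreesOracle`).
* §2 `Malleable`: the mutant whose names are masked labels WITHOUT ciphertext integrity is broken —
  `dec_forge` (an alias of EXIT forged from `name(ENTRANCE)` and public labels), `forge_ne_name`,
  `canonical_rejects_forge` (typing obligation: `N_k` must reject every non-canonical string).
* Sequel `GrowthClosure.lean` (II): the growth closure of the BPR15 plant-and-grow template on an
  undirected neighbour circuit is ONE round (threshold-equals-degree percolation) — formal core of the
  route's kill criterion (b).
-/

set_option linter.dupNamespace false

namespace Summit.QuantumAdvantage.QuantumAdvantage.Theorems.WbwObfuscatedGluedTrees.Negative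

open Literature.Computability.Cryptography Literature.Computability.Complexity
open Literature.Computability.QuantumComplexity
open Filter Asymptotics

/-! ## §0 The typed shape of the informal crux, and why `¬` cannot be unconditional -/

/-- Clause (C) of `WbwThesis` for a fixed generator/answer pair `(gen, ans)`: every PPT `A`, given
`(1ⁿ, gen s)` for uniform `s ∈ {0,1}ⁿ`, outputs a string with prefix `ans s` with probability
decaying superpolynomially in `n`. Verbatim sub-formula of the route decl. [folklore] -/
def ClauseC (gen ans : List Bool → List Bool) : Prop :=
  ∀ A : RandAlg (List Bool) (List Bool), IsPPT A id →
    SuperpolynomialDecay atTop (fun n : ℕ => (n : ℝ)) (fun n : ℕ =>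
      uniformAvg n fun s => A.pr id (boolPair (Computability.unaryEncodeNat n) (gen s)) {y | ans s <+: y})

/-- Restates-the-target check: the thesis is `∃ gen ans, FP ∧ length ∧ (Q) ∧ ClauseC gen ans`
definitionally; the crux asserts `ClauseC` for ONE specific pair under EXTRA hypotheses, so it is a
proper sub-goal, not the target in other words. [folklore] -/
theorem wbwThesis_iff :
    Summit.QuantumAdvantage.QuantumAdvantage.Theses.WhiteBoxWalk.WbwThesis ↔
      ∃ (gen ans : List Bool → List Bool), PolyTimeComputable id id gen ∧
        (∃ p : Polynomial ℕ, ∀ s, (ans s).length = p.eval (gen s).length) ∧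
        (∃ F : QCircuitFamily cliffordT, F.IsOracleFree ∧ F.IsUniform ∧
          ∀ s, 2 / 3 ≤ F.kernelProb 0 (gen s) {y | ans s <+: y}) ∧ ClauseC gen ans :=
  Iff.rfl

/-- The type of the missing definition `obfuscatedGluedTreesGen`: from an obfuscator `O`, a
puncturable-PRF scheme `P`, an injective one-way function `f` and the exponent `c` (`λ = n^c`) it
must produce the pair `(gen, ans)`. (Typing obligation T1 of the previous attack: the primitives are
FED to the generator; the existential `SubexpIOExist` cannot parametrise a fixed `gen`.) [folklore] -/
abbrev GenType : Type :=
  CircuitObfuscator → PuncturablePRFScheme → (List Bool → List Bool) → ℕ →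
    (List Bool → List Bool) × (List Bool → List Bool)

/-- `CruxShape obfGen`: the typed shape of the crux once the generator lands — for every
`ε ∈ (0,1)`, every `(2^{κ^ε}, 2^{-κ^ε})`-secure iO `O` for `P/poly`, every `(2^{κ^ε}, 2^{-κ^ε})`-secure
puncturable PRF `P`, every injective one-way `f` and every `c` with `c·ε > 1` (BPR15 §5.1
parameters; T3), clause (C) holds for `obfGen O P f c`. [folklore] -/
def CruxShape (obfGen : GenType) : Prop :=
  ∀ ε : ℝ, 0 < ε → ε < 1 → ∀ O : CircuitObfuscator, IsSubexpIO ε ppolyCircuits O →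
    ∀ P : PuncturablePRFScheme,
      IsTDSecurePuncturablePRF P (fun κ => (2 : ℝ) ^ ((κ : ℝ) ^ ε))
        (fun κ => (2 : ℝ) ^ (-((κ : ℝ) ^ ε))) →
      ∀ f : List Bool → List Bool, IsOneWay f → Function.Injective f →
        ∀ c : ℕ, 1 < (c : ℝ) * ε → ClauseC (obfGen O P f c).1 (obfGen O P f c).2

/-- If sub-exponentially secure iO does not exist for any `ε ∈ (0,1)`, the crux holds VACUOUSLY,
whatever the generator. [folklore] -/
theorem cruxShape_of_no_subexpIO (obfGen : GenType)
    (h : ∀ ε : ℝ, 0 < ε → ε < 1 → ¬ SubexpIOExist ε) : CruxShape obfGen := by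
  intro ε hε hε1 O hO
  exact absurd ⟨O, hO⟩ (h ε hε hε1)

/-- If injective one-way functions do not exist, the crux holds VACUOUSLY. [folklore] -/
theorem cruxShape_of_no_injectiveOWF (obfGen : GenType)
    (h : ∀ f : List Bool → List Bool, IsOneWay f → ¬ Function.Injective f) : CruxShape obfGen := by
  intro ε _ _ O _ P _ f hf hinj
  exact absurd hinj (h f hf)

/-- **Why no unconditional refutation can be landed.** A proof of `¬ CruxShape obfGen` yields, in
particular, a sub-exponentially secure iO for `P/poly` (for some `ε ∈ (0,1)`), a `(t,δ)`-secure
puncturable PRF and an injective one-way function — each an unproved cryptographic existence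
statement (the last one implies `NP ⊄ BPP`). Hence the refuter lane for this crux is at best a
negative lemma MODULO `H = (subexp iO ∧ (t,δ)-PPRF ∧ injective OWF exist)`, and modulo `H` a kill is
a universal white-box EXIT-finder. [folklore] -/
theorem not_cruxShape_imp (obfGen : GenType) (h : ¬ CruxShape obfGen) :
    (∃ ε : ℝ, 0 < ε ∧ ε < 1 ∧ SubexpIOExist ε ∧
      ∃ P : PuncturablePRFScheme, IsTDSecurePuncturablePRF P (fun κ => (2 : ℝ) ^ ((κ : ℝ) ^ ε))
        (fun κ => (2 : ℝ) ^ (-((κ : ℝ) ^ ε)))) ∧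
    ∃ f : List Bool → List Bool, IsOneWay f ∧ Function.Injective f := by
  by_contra hcon
  apply h
  intro ε hε hε1 O hO P hP f hf hinj c _
  exfalso
  apply hcon
  exact ⟨⟨ε, hε, hε1, ⟨O, hO⟩, P, hP⟩, f, hf, hinj⟩

/-! ## Graph facts used below (the tree's `GluedTrees` API) -/

namespace Graph

open GluedTrees

variable {n : ℕ}

/-- A vertex of depth `0` on the left is the ENTRANCE. [folklore] -/
theorem eq_entrance_of_depth_eq_zero {v : Vertex n} (hv : depth v = 0) (hb : v.1 = false) :
    v = entrance n := by
  have hidx : idx v = 0 := by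
    have := idx_lt v
    rw [hv] at this
    omega
  exact Vertex.ext_iff'.mpr ⟨hb, hv, hidx⟩

/-- A vertex of depth `0` on the right is the EXIT. [folklore] -/
theorem eq_exit_of_depth_eq_zero {v : Vertex n} (hv : depth v = 0) (hb : v.1 = true) :
    v = GluedTrees.exit n := by
  have hidx : idx v = 0 := by
    have := idx_lt v
    rw [hv] at this
    omega
  exact Vertex.ext_iff'.mpr ⟨hb, hv, hidx⟩

/-- **EXIT is publicly verifiable**: for `1 ≤ n` the vertices of degree `2` are exactly the two
roots (everything else has degree `3`, `GluedTrees.degree_eq`). So a candidate answer is checked with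
one evaluation of the neighbour circuit ("valid, two neighbours, not the ENTRANCE"), which is what
makes an attack on one iO transfer to all (re-obfuscate and compare success rates). [folklore] -/
theorem degree_eq_two_iff (hn : 1 ≤ n) (σ : CycleDatum n) (v : Vertex n) :
    (graph n σ).degree v = 2 ↔ v = entrance n ∨ v = GluedTrees.exit n := by
  rw [degree_eq hn]
  constructor
  · intro h
    have hv : depth v = 0 := by
      by_contra h0
      rw [if_neg h0] at h
      omega
    cases hb : v.1
    · exact Or.inl (eq_entrance_of_depth_eq_zero hv hb)
    · exact Or.inr (eq_exit_of_depth_eq_zero hv hb)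
  · rintro (rfl | rfl) <;> simp

/-- Children are neighbours. [folklore] -/
theorem adj_childV (σ : CycleDatum n) {v : Vertex n} (hv : depth v < n) (b : Bool) :
    (graph n σ).Adj v (childV v b) := by
  rw [← SimpleGraph.mem_neighborFinset, neighborFinset_of_depth_lt σ hv]
  cases b <;> simp

/-- The parent is a neighbour. [folklore] -/
theorem adj_parentV (hn : 1 ≤ n) (σ : CycleDatum n) {v : Vertex n} (hv : 1 ≤ depth v) :
    (graph n σ).Adj v (parentV v) := by
  by_cases hvn : depth v < n
  · rw [← SimpleGraph.mem_neighborFinset, neighborFinset_of_depth_lt σ hvn, if_neg (by omega)]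
    simp
  · have hv' : depth v = n := le_antisymm (depth_le v) (not_lt.mp hvn)
    obtain ⟨i, rfl | rfl⟩ := exists_eq_leaf hv'
    · rw [← SimpleGraph.mem_neighborFinset, neighborFinset_leafL hn]; simp
    · rw [← SimpleGraph.mem_neighborFinset, neighborFinset_leafR hn]; simp

/-- The first cross (glued) neighbour of a leaf is a neighbour. [folklore] -/
theorem adj_cross₁ (hn : 1 ≤ n) (σ : CycleDatum n) {v : Vertex n} (hv : depth v = n) :
    (graph n σ).Adj v (cross₁ σ v) := by
  obtain ⟨i, rfl | rfl⟩ := exists_eq_leaf hv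
  · rw [← SimpleGraph.mem_neighborFinset, neighborFinset_leafL hn, cross₁_leafL]; simp
  · rw [← SimpleGraph.mem_neighborFinset, neighborFinset_leafR hn, cross₁_leafR]; simp

/-- The only root adjacent to a child of EXIT is EXIT (`1 ≤ n`): the degree-2 test identifies the
canonical name of EXIT among the three names returned on a child of EXIT. [folklore] -/
theorem eq_exit_of_adj_child_exit (hn : 1 ≤ n) (σ : CycleDatum n) (b : Bool) {w : Vertex n}
    (hw : (graph n σ).Adj (childV (GluedTrees.exit n) b) w) (hdeg : (graph n σ).degree w = 2) :
    w = GluedTrees.exit n := by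
  rcases (degree_eq_two_iff hn σ w).1 hdeg with rfl | rfl
  · exfalso
    have h0 : depth (entrance n) < n := by simp; omega
    have hw' := hw.symm
    rw [← SimpleGraph.mem_neighborFinset, neighborFinset_of_depth_lt σ h0, if_pos depth_entrance,
      Finset.empty_union, Finset.mem_insert, Finset.mem_singleton] at hw'
    have hside : (childV (GluedTrees.exit n) b).1 = true := by rw [childV_fst]; rfl
    rcases hw' with h | h <;> rw [h, childV_fst] at hside <;> simp at hside
  · rfl

end Graph

/-! ## §1 Load-bearing hypothesis: the canonical (sorted) order of the adjacency lists

If the neighbour circuit lists the neighbours in ROLE order — `[parent] ++ [child₀, child₁]` at an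
inner vertex, `[parent] ++ [glued₁, glued₂]` at a leaf — then evaluating it hands the adversary the
maps `parentV`, `childV · false`, `cross₁` at the level of names, and the following `2n+1`-step walk
outputs EXIT on every instance (probability 1, no cryptographic assumption touched). `descend` and
`ascend` are walks in `G'_n(σ)` (`Graph.adj_childV`, `Graph.adj_parentV`, `Graph.adj_cross₁`). The
tree's `gluedTreesOracle` sorts by binary value precisely to exclude this (its docstring says so);
the informal item text ("list of ≤ 3 neighbour names") does not fix the order — typing obligation. -/

namespace RoleOrder

open GluedTrees

variable {n : ℕ}

/-- Go down `k` levels along first children. [folklore] -/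
def descend (v : Vertex n) : ℕ → Vertex n
  | 0 => v
  | k + 1 => childV (descend v k) false

/-- Go up `k` levels. [folklore] -/
def ascend (v : Vertex n) : ℕ → Vertex n
  | 0 => v
  | k + 1 => parentV (ascend v k)

/-- The role walk: `n` steps down from the ENTRANCE, one glued edge, `n` steps up. [folklore] -/
def roleWalk (σ : CycleDatum n) : Vertex n :=
  ascend (cross₁ σ (descend (entrance n) n)) n

/-- `k ≤ n` down-steps from the ENTRANCE stay on the left and reach depth `k`. [folklore] -/
theorem descend_spec (k : ℕ) (hk : k ≤ n) :
    (descend (entrance n) k).1 = false ∧ depth (descend (entrance n) k) = k := by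
  induction k with
  | zero => exact ⟨rfl, rfl⟩
  | succ k ih =>
    obtain ⟨h1, h2⟩ := ih (by omega)
    have hlt : depth (descend (entrance n) k) < n := by omega
    refine ⟨?_, ?_⟩
    · show (childV (descend (entrance n) k) false).1 = false
      rw [childV_fst, h1]
    · show depth (childV (descend (entrance n) k) false) = k + 1
      rw [depth_childV hlt, h2]

/-- `k` up-steps keep the side and decrease the depth by `k`. [folklore] -/
theorem ascend_spec (v : Vertex n) (k : ℕ) :
    (ascend v k).1 = v.1 ∧ depth (ascend v k) = depth v - k := by
  induction k with
  | zero => exact ⟨rfl, rfl⟩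
  | succ k ih =>
    obtain ⟨h1, h2⟩ := ih
    refine ⟨?_, ?_⟩
    · show (parentV (ascend v k)).1 = v.1
      rw [parentV_fst, h1]
    · show depth (parentV (ascend v k)) = depth v - (k + 1)
      rw [depth_parentV, h2]
      omega

/-- **The role-ordered mutant is broken**: the role walk ends at the EXIT, for every `n` and every
cycle datum `σ` (for `n = 0` as well, where `cross₁` of the ENTRANCE-leaf is the EXIT-leaf). [folklore] -/
theorem roleWalk_eq_exit (σ : CycleDatum n) : roleWalk σ = GluedTrees.exit n := by
  obtain ⟨hs, hd⟩ := descend_spec (n := n) n le_rfl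
  have hc1 : (cross₁ σ (descend (entrance n) n)).1 = true := by
    rw [cross₁_fst hd, hs]; rfl
  have hc2 : depth (cross₁ σ (descend (entrance n) n)) = n := depth_cross₁ hd
  obtain ⟨ha1, ha2⟩ := ascend_spec (cross₁ σ (descend (entrance n) n)) n
  have h0 : depth (roleWalk σ) = 0 := by
    show depth (ascend (cross₁ σ (descend (entrance n) n)) n) = 0
    rw [ha2, hc2]; simp
  have h1 : (roleWalk σ).1 = true := by
    show (ascend (cross₁ σ (descend (entrance n) n)) n).1 = true
    rw [ha1, hc1]
  exact Graph.eq_exit_of_depth_eq_zero h0 h1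

/-- Each step of the role walk is an edge of `G'_n(σ)` (`1 ≤ n`): down-steps. [folklore] -/
theorem adj_descend_succ (σ : CycleDatum n) (k : ℕ) (hk : k < n) :
    (graph n σ).Adj (descend (entrance n) k) (descend (entrance n) (k + 1)) := by
  have := (descend_spec (n := n) k hk.le).2
  exact Graph.adj_childV σ (by omega) false

/-- Each step of the role walk is an edge of `G'_n(σ)` (`1 ≤ n`): the glued step. [folklore] -/
theorem adj_glued_step (hn : 1 ≤ n) (σ : CycleDatum n) :
    (graph n σ).Adj (descend (entrance n) n) (cross₁ σ (descend (entrance n) n)) :=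
  Graph.adj_cross₁ hn σ (descend_spec (n := n) n le_rfl).2

/-- Each step of the role walk is an edge of `G'_n(σ)` (`1 ≤ n`): up-steps. [folklore] -/
theorem adj_ascend_succ (hn : 1 ≤ n) (σ : CycleDatum n) (k : ℕ) (hk : k < n) :
    (graph n σ).Adj (ascend (cross₁ σ (descend (entrance n) n)) k)
      (ascend (cross₁ σ (descend (entrance n) n)) (k + 1)) := by
  have hd := (descend_spec (n := n) n le_rfl).2
  have hc2 : depth (cross₁ σ (descend (entrance n) n)) = n := depth_cross₁ hd
  have := (ascend_spec (cross₁ σ (descend (entrance n) n)) k).2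
  exact Graph.adj_parentV hn σ (by omega)

end RoleOrder

/-! ## §2 Load-bearing hypothesis: ciphertext integrity of the names (no aliases)

Abstract model of the item's example scheme `name(v) = (r(v), F(r(v)) ⊕ label(v), tag)` with the
integrity checks (tag verification, `r = F''(label)` re-derivation) DROPPED: names live in `R × L`
with `L` an additive group (bit strings under XOR), `name v = (r v, pad (r v) + lab v)` for a PUBLIC
injective labelling `lab` (the canonical vertex code — the adversary knows `lab (entrance n)` and
`lab (exit n)`, they are fixed strings) and arbitrary secret `r`, `pad` (PRF values). The
integrity-free decoder accepts every pair whose unmasked value is a label. Then the adversary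
forges, from `name(ENTRANCE)` alone, a string that decodes to EXIT (`dec_forge`) although it is not
a canonical name (`forge_ne_name`, when `r` is injective as for `r = F''(label)` with an injective
PRF slice): the neighbour circuit evaluated on it returns EXIT's two children; evaluated on a child
it returns three canonical names one of which is `name(EXIT)`, singled out by the degree-2 test
(`Graph.eq_exit_of_adj_child_exit`): `ans s` in at most `1 + 1 + 3 = 5` evaluations, probability 1.
So "reject unless canonical" (and a single fixed `⊥`) must be built into the typed `N_k`. -/

namespace Malleable

open GluedTrees

variable {n : ℕ} {R L : Type} [AddCommGroup L]

/-- Masked naming data: secret randomiser `r`, secret pad `pad` (PRF), public injective labels. [folklore] -/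
structure Scheme (n : ℕ) (R L : Type) [AddCommGroup L] where
  /-- The secret randomiser `r(v)` (e.g. `F''(label v)`). -/
  r : Vertex n → R
  /-- The secret pad `F(r)`. -/
  pad : R → L
  /-- The PUBLIC injective labelling (canonical vertex code). -/
  lab : Vertex n ↪ L

/-- The name of a vertex: `(r v, pad (r v) + lab v)`. [folklore] -/
def Scheme.name (S : Scheme n R L) (v : Vertex n) : R × L := (S.r v, S.pad (S.r v) + S.lab v)

open Classical in
/-- The integrity-free decoder: unmask and look the label up. [folklore] -/
noncomputable def Scheme.dec (S : Scheme n R L) (a : R × L) : Option (Vertex n) :=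
  if h : ∃ v, S.lab v = a.2 - S.pad a.1 then some h.choose else none

/-- The forgery: re-target the ENTRANCE's name at the EXIT using public labels only. [folklore] -/
def Scheme.forge (S : Scheme n R L) (aE : R × L) : R × L :=
  (aE.1, aE.2 - S.lab (entrance n) + S.lab (GluedTrees.exit n))

/-- Canonical names decode correctly. [folklore] -/
theorem dec_name (S : Scheme n R L) (v : Vertex n) : S.dec (S.name v) = some v := by
  unfold Scheme.dec Scheme.name
  have hex : ∃ w, S.lab w = (S.pad (S.r v) + S.lab v) - S.pad (S.r v) := ⟨v, by abel⟩
  rw [dif_pos hex]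
  congr 1
  apply S.lab.injective
  rw [hex.choose_spec]
  abel

/-- **The forged string decodes to EXIT.** [folklore] -/
theorem dec_forge (S : Scheme n R L) : S.dec (S.forge (S.name (entrance n))) = some (GluedTrees.exit n) := by
  unfold Scheme.dec Scheme.forge Scheme.name
  have hex : ∃ w, S.lab w =
      (S.pad (S.r (entrance n)) + S.lab (entrance n) - S.lab (entrance n) + S.lab (GluedTrees.exit n)) -
        S.pad (S.r (entrance n)) := ⟨GluedTrees.exit n, by abel⟩
  rw [dif_pos hex]
  congr 1
  apply S.lab.injective
  rw [hex.choose_spec]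
  abel

/-- The forged string is NOT the canonical name of EXIT as soon as the randomisers of ENTRANCE and
EXIT differ (e.g. `r = F''(label)` injective): it is a genuine alias, invisible to any party that
only compares against canonical names, and rejected by an integrity-checking decoder. [folklore] -/
theorem forge_ne_name (S : Scheme n R L) (hr : S.r (entrance n) ≠ S.r (GluedTrees.exit n)) :
    S.forge (S.name (entrance n)) ≠ S.name (GluedTrees.exit n) := by
  intro h
  have := congrArg Prod.fst h
  exact hr this

/-- With an integrity-checking decoder (accept `a` only if `a = name v`), the forgery is rejected. [folklore] -/
theorem canonical_rejects_forge (S : Scheme n R L) (hr : Function.Injective S.r) :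
    ¬ ∃ v, S.forge (S.name (entrance n)) = S.name v := by
  rintro ⟨v, hv⟩
  have h1 : S.r (entrance n) = S.r v := congrArg Prod.fst hv
  have hvE : v = entrance n := (hr h1).symm
  subst hvE
  have h2 := congrArg Prod.snd hv
  simp only [Scheme.forge, Scheme.name] at h2
  have : S.lab (GluedTrees.exit n) = S.lab (entrance n) := by
    have h3 : S.pad (S.r (entrance n)) + S.lab (entrance n) - S.lab (entrance n) + S.lab (GluedTrees.exit n)
        - (S.pad (S.r (entrance n)) + S.lab (entrance n)) = 0 := by rw [h2]; abel
    have h4 : S.pad (S.r (entrance n)) + S.lab (entrance n) - S.lab (entrance n) + S.lab (GluedTrees.exit n)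
        - (S.pad (S.r (entrance n)) + S.lab (entrance n)) = S.lab (GluedTrees.exit n) - S.lab (entrance n) := by abel
    rw [h4] at h3
    exact sub_eq_zero.mp h3
  exact absurd (S.lab.injective this) (entrance_ne_exit n).symm

end Malleable

end Summit.QuantumAdvantage.QuantumAdvantage.Theorems.WbwObfuscatedGluedTrees.Negative
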